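import Summits.QuantumFields.BalabanUV.Beta.GAN24.DerivativeRateTransferJensenIntertwine

/-!
# `BalabanUV.Beta.GAN24.DerivativeRateTransferCovariantLift` — binder row G-an2-4 ∕ (CONV-C), route R6 «VALUES, NOT DERIVATIVES», PART 33:
# (PROL) WITH A BACKGROUND BY SUBSTITUTION — the covariant intertwining identity of a prolongation IS the FLAT identity applied to transported component
# functions plus an explicit holonomy defect; the intertwining weights are the FLAT ones; no smallness, no orthogonality for the identity; with orthogonal
# transporters and loop defects `κ₁, κ₂` the defect has mass `≤ K·|u|²`, and PART 28's intertwining Jensen gives (PROL-ε,δ)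
# (unit b2b-balaban-gan24-p3, gen 38; v1.1 — the shape of gan24-idea-1 g44's lens item «covariant lift by substitution», Q-44-1, typed at its first refusal; v1.1 = v1 +
# idea-1 g44's sharpness amendment S-44-1: the ROW MASS `ρ` of the intertwining weights is carried — on the lattice `ρ = R⁻¹`, and the `ρ = 1` form is not instantiable
# at true stiffness; v1.2 = v1.1 + §4, APPENDED (§1–§3 byte-identical): a background SLACK `λ|v|²` in the fine form — idea-1 g44's letter question Q-44-3 —
# so that the fine-form hypothesis is satisfiable when `H′` is the ACTION form at a background, not the bond-energy form)

NOT IN PRINT; OUR PROOF (for the ROUTE; [folklore] finite sums over ℝ + PART 21's Jensen ∕ Peter–Paul letters + PART 28 `posSemidef_intertwine_jensen` BY NAME).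
HONEST FRAMING (cell contract, verbatim): «discharging `BetaPertH` makes Bałaban's UV stability UNCONDITIONAL — a real constructive-QFT result; it is NOT the continuum
limit and NOT the Clay problem.»  HONEST DEPENDENCY (verbatim): «continuum YM on T⁴ ⇐ BetaPertH ∧ nine spine estimates (0/9 proved); BetaPertH ⇐ (D1) ∧ (D4) ∧
CAP+tail; G-an2-4 gates asym, D1 and NE2/3/4.»

WHY THIS FILE.  After PARTs 29–32 route R6's debt line reads «(CONS)(s,t) REPLACED by (PROL-ε,δ)(s,t) [PART 28 + the covariant intertwining identity of the
prolongation: UNTYPED] + (ROW)(s,t) [✓] + Λ + …» (PRICING-GAN24 v3.38; ROUTES v43).  gan24-idea-1 g44 observed that the covariant identity needs no covariant tensor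
recursion: if the FLAT prolongation weights `a(x′,k)` satisfy the flat intertwining identity (L) `Σ_k a(tgt′b′,k)·v_k − Σ_k a(src′b′,k)·v_k = Σ_b q(b′,b)·(v(tgt b) −
v(src b))` for every vector-valued `v` (at `U = 1` for the multilinear prolongation: gan24-p2's `MultilinearProlongation.Pml_step`, `q = vwt∕R` on the transverse face),
then for the COVARIANT prolongation `(P_O u)(x′) = Σ_k a(x′,k)·O(x′,k)u_k` (corner values transported along contours `O`) and ANY bond transporters `V` (fine), `U`
(coarse):  `V_{b′}(P_O u)(tgt′b′) − (P_O u)(src′b′) = Σ_b q(b′,b)·Ō(src b)(U_b u(tgt b) − u(src b)) + E u b′`,  `Ō := O(src′b′,·)`,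
`E u b′ = Σ_k a(tgt′b′,k)·(V_{b′}O(tgt′b′,k) − Ō(k))u_k + Σ_b q(b′,b)·(Ō(tgt b) − Ō(src b)U_b)u(tgt b)` — (L) at `v_k := Ō(k)u_k`, and subtract.  The two
brackets are loop holonomies minus one (`k → tgt′b′ → src′b′ → k` and `tgt b → src b → src′b′ → tgt b`); with defects `κ₁, κ₂`, Jensen over `a` (row sums ≤ 1) and `q`
(row sums ≤ ρ) and the column counts, `Σ_{b′}|E u b′|² ≤ (2κ₁²α + 2κ₂²ρmg)·|u|²` — PART 28's `hE` — and PART 28, applied to the RESCALED weights `ρ⁻¹q` and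
differences `ρ•Du` (S-44-1: PART 28's Jensen wants row sums ≤ 1; the rescaling keeps `q•W(Du)` and turns its slack condition into `w′·m·ρ ≤ w`), gives (PROL-ε,δ)
for EVERY `t > 0`.  THE WEIGHTS `q` ARE THE FLAT ONES: every count (row mass `ρ`, column multiplicity `m`) is the `U = 1` computation (multilinear, blocking
factor `R`, dimension `d`: `ρ = R⁻¹`, `m = R^{d−1}`, `α = R^d`, `w′∕w = R^{2−d}`, so `w′mρ = w` — gan24-idea-1 g44's count, gan24-p2's `sum_vwt` ∕ `energy_Pml_le`).

WHAT THIS FILE PROVES (0 sorry, 0 `def`, nothing cited; colour site fields `u : X × o → ℝ`):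
* §1 **`covariantLift_of_flat`** — the identity (pure algebra; no smallness, no orthogonality).
* §2 `dotProduct_self_two_add_le` (`|a + b|² ≤ 2|a|² + 2|b|²`), `dotProduct_self_wsum_le_mass` (Jensen with row mass `ρ`: `|Σ q•w|² ≤ ρ·Σ q|w|²`),
  **`defect_sq_le`** (`|E u b′|² ≤ 2κ₁²·Σ_k a(tgt′b′,k)|u_k|² + 2κ₂²ρ·Σ_b q(b′,b)|u(tgt b)|²`), **`sum_defect_sq_le`** (`Σ_{b′}|E u b′|² ≤ (2κ₁²α + 2κ₂²ρmg)·|u|²`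
  from the column sums `Σ_{b′} a(tgt′b′,k) ≤ α`, `Σ_{b′} q(b′,b) ≤ m` and the in-degree count `Σ_b |u(tgt b)|² ≤ g·|u|²`).
* §3 `sum_rescale_smul_mulVec`, `sum_smul_dotProduct_smul` (rescaling letters), **`prolGram_of_flat`** — (PROL-ε,δ) FROM THE FLAT IDENTITY: structure `hP` of the
  covariant prolongation, (L), orthogonal `O`, `q ≥ 0` with row sums `≤ ρ` (`0 < ρ`) and column sums `≤ m`, `a ≥ 0` with row sums `≤ 1` and column sums `≤ α`, the
  defects `κ₁, κ₂`, the in-degree count `g`, the coarse form above `w·Σ_b|U_bu(tgt b) − u(src b)|²`, the fine form below `w′·Σ_{b′}|V_{b′}v(tgt′b′) − v(src′b′)|²`,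
  `w′·m·ρ ≤ w` ⟹ for every `t > 0`:  `((1 + t)•H + ((1 + t⁻¹)·w′·(2κ₁²α + 2κ₂²ρmg))•1 − PᵀH′P).PosSemidef`.
* §4 **`gram_le_colMass`** (`(α′•1 − PᵀP).PosSemidef` from the fine-site column count `Σ_{x′} a(x′,k) ≤ α′`, row sums ≤ 1, orthogonal contours),
  **`prolGram_of_flat_slack`** (§3 with `⟨v,H′v⟩ ≤ w′·Σ|D′_V v|² + λ|v|²`, `0 ≤ λ` ⟹ `((1 + t)•H + ((1 + t⁻¹)·w′·(2κ₁²α + 2κ₂²ρmg) + λα′)•1 − PᵀH′P).PosSemidef`).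
WHAT IT DOES NOT DO: prove (L) for any prolongation (U = 1 multilinear: p2's `Pml_step`, over ℂ — an ℝ copy is field-agnostic finite sums, not this file); feed
`κ₁, κ₂` (PART 25 ∕ 27 at the consumer's); identify `O, V, U` with Bałaban's (S2(ii)).  SUPPLIER work on route R6 (rank 2, REDUCTION, no seat); no consumer of record;
NEVER «G-an2-4 closed»; NOT (CONV-C), NOT D1, NOT `BetaPertH`, NOT continuum, NOT Clay.  Records: `HOME/b2b-balaban-gan24-p3/WOODBURY-FIBRE.md` v13.8.
-/

noncomputable section

open Matrix Finset

namespace Summit.QuantumFields.BalabanUV.Beta.GAN24.DerivativeRateTransferCovariantLift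

open Summit.QuantumFields.BalabanUV.Beta.GAN24.DerivativeRateTransferJensenChain
open Summit.QuantumFields.BalabanUV.Beta.GAN24.DerivativeRateTransferJensenIntertwine (posSemidef_intertwine_jensen)

variable {o X X' B B' : Type*} [Fintype o] [DecidableEq o] [Fintype X] [Fintype X'] [Fintype B] [Fintype B']

/-! ## §1 The identity: the flat intertwining identity, lifted by substitution -/

section Identity

omit [DecidableEq o] [Fintype X'] [Fintype B'] in
/-- **`covariantLift_of_flat` — (PROL)'s COVARIANT INTERTWINING IDENTITY BY SUBSTITUTION** [our proof; gan24-idea-1 g44's lens item]: if the flat prolongation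
weights `a` and intertwining weights `q` satisfy (L) `Σ_k a(tgt′b′,k)•v_k − Σ_k a(src′b′,k)•v_k = Σ_b q(b′,b)•(v(tgt b) − v(src b))` for every `v : X → o → ℝ`, then
for ANY transports `O` (contours), `V` (fine bonds), `U` (coarse bonds) and every `u`:
`V_{b′}·Σ_k a(tgt′b′,k)•O(tgt′b′,k)u_k − Σ_k a(src′b′,k)•O(src′b′,k)u_k = Σ_b q(b′,b)•O(src′b′,src b)(U_bu(tgt b) − u(src b)) + E`,
`E = Σ_k a(tgt′b′,k)•(V_{b′}O(tgt′b′,k) − O(src′b′,k))u_k + Σ_b q(b′,b)•(O(src′b′,tgt b) − O(src′b′,src b)U_b)u(tgt b)` — no smallness, no orthogonality. -/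
theorem covariantLift_of_flat (a : X' → X → ℝ) (q : B' → B → ℝ) (src tgt : B → X) (src' tgt' : B' → X')
    (hL : ∀ (v : X → o → ℝ) (b' : B'),
      ∑ k, a (tgt' b') k • v k - ∑ k, a (src' b') k • v k = ∑ b, q b' b • (v (tgt b) - v (src b)))
    (O : X' → X → Matrix o o ℝ) (V : B' → Matrix o o ℝ) (U : B → Matrix o o ℝ) (u : X → o → ℝ) (b' : B') :
    V b' *ᵥ (∑ k, a (tgt' b') k • (O (tgt' b') k *ᵥ u k)) - ∑ k, a (src' b') k • (O (src' b') k *ᵥ u k) =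
      ∑ b, q b' b • (O (src' b') (src b) *ᵥ (U b *ᵥ u (tgt b) - u (src b)))
        + (∑ k, a (tgt' b') k • ((V b' * O (tgt' b') k - O (src' b') k) *ᵥ u k)
          + ∑ b, q b' b • ((O (src' b') (tgt b) - O (src' b') (src b) * U b) *ᵥ u (tgt b))) := by
  have h := hL (fun k => O (src' b') k *ᵥ u k) b'
  have e1 : ∀ k, a (tgt' b') k • ((V b' * O (tgt' b') k) *ᵥ u k) =
      a (tgt' b') k • (O (src' b') k *ᵥ u k) + a (tgt' b') k • ((V b' * O (tgt' b') k - O (src' b') k) *ᵥ u k) := by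
    intro k; rw [← smul_add, sub_mulVec]; congr 1; abel
  have e2 : ∀ b, q b' b • (O (src' b') (tgt b) *ᵥ u (tgt b) - O (src' b') (src b) *ᵥ u (src b)) =
      q b' b • (O (src' b') (src b) *ᵥ (U b *ᵥ u (tgt b) - u (src b)))
        + q b' b • ((O (src' b') (tgt b) - O (src' b') (src b) * U b) *ᵥ u (tgt b)) := by
    intro b; rw [← smul_add, mulVec_sub, mulVec_mulVec, sub_mulVec]; congr 1; abel
  simp_rw [e2, Finset.sum_add_distrib] at h
  rw [Matrix.mulVec_sum]
  simp_rw [Matrix.mulVec_smul, Matrix.mulVec_mulVec, e1, Finset.sum_add_distrib]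
  rw [show ∑ k, a (tgt' b') k • (O (src' b') k *ᵥ u k) + ∑ k, a (tgt' b') k • ((V b' * O (tgt' b') k - O (src' b') k) *ᵥ u k)
        - ∑ k, a (src' b') k • (O (src' b') k *ᵥ u k)
      = (∑ k, a (tgt' b') k • (O (src' b') k *ᵥ u k) - ∑ k, a (src' b') k • (O (src' b') k *ᵥ u k))
        + ∑ k, a (tgt' b') k • ((V b' * O (tgt' b') k - O (src' b') k) *ᵥ u k) by abel, h]
  abel

end Identity

/-! ## §2 The defect has mass `≤ K·|u|²` -/

section Defect

omit [DecidableEq o] in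
/-- `|a + b|² ≤ 2|a|² + 2|b|²` (Peter–Paul at `t = 1`). [folklore] -/
theorem dotProduct_self_two_add_le (v w : o → ℝ) : (v + w) ⬝ᵥ (v + w) ≤ 2 * (v ⬝ᵥ v) + 2 * (w ⬝ᵥ w) := by
  have h := dotProduct_self_add_le v w one_pos
  simp only [inv_one] at h
  linarith

omit [DecidableEq o] in
/-- **WEIGHTED JENSEN WITH ROW MASS `ρ`** (no transport): weights `q_x ≥ 0` with `Σ_x q_x ≤ ρ` ⟹ `|Σ_x q_x·w_x|² ≤ ρ·Σ_x q_x·|w_x|²` (coordinatewise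
Cauchy–Schwarz, PART 27's letters; `ρ = 1` is PART 27 `dotProduct_self_wsum_le'`). [folklore] -/
theorem dotProduct_self_wsum_le_mass {ν : Type*} (s : Finset ν) {q : ν → ℝ} {ρ : ℝ} (hq : ∀ x ∈ s, 0 ≤ q x) (hq1 : ∑ x ∈ s, q x ≤ ρ)
    (w : ν → o → ℝ) :
    (∑ x ∈ s, q x • w x) ⬝ᵥ (∑ x ∈ s, q x • w x) ≤ ρ * ∑ x ∈ s, q x * (w x ⬝ᵥ w x) := by
  have lhs : (∑ x ∈ s, q x • w x) ⬝ᵥ (∑ x ∈ s, q x • w x) = ∑ a, (∑ x ∈ s, q x * w x a) * (∑ x ∈ s, q x * w x a) := by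
    simp only [dotProduct, Finset.sum_apply, Pi.smul_apply, smul_eq_mul]
  have rhs : ρ * ∑ x ∈ s, q x * (w x ⬝ᵥ w x) = ∑ a, ρ * ∑ x ∈ s, q x * (w x a * w x a) := by
    simp only [dotProduct, Finset.mul_sum]; exact Finset.sum_comm
  rw [lhs, rhs]
  refine Finset.sum_le_sum fun a _ => ?_
  have hcs := Finset.sum_sq_le_sum_mul_sum_of_sq_le_mul s (r := fun x => q x * w x a) (f := q)
    (g := fun x => q x * (w x a * w x a)) hq (fun x hx => mul_nonneg (hq x hx) (mul_self_nonneg _))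
    (fun x _ => by ring_nf; nlinarith [sq_nonneg (q x * w x a)])
  have hg0 : 0 ≤ ∑ x ∈ s, q x * (w x a * w x a) := Finset.sum_nonneg fun x hx => mul_nonneg (hq x hx) (mul_self_nonneg _)
  rw [sq] at hcs
  exact hcs.trans (mul_le_mul_of_nonneg_right hq1 hg0)

omit [DecidableEq o] [Fintype X'] [Fintype B'] in
/-- **`defect_sq_le` — ONE FINE BOND**: weights `a(tgt′b′,·) ≥ 0` with `Σ_k a(tgt′b′,k) ≤ 1`, `q(b′,·) ≥ 0` with row mass `Σ_b q(b′,b) ≤ ρ`, loop defects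
`|(V_{b′}O(tgt′b′,k) − O(src′b′,k))w|² ≤ κ₁²|w|²` and `|(O(src′b′,tgt b) − O(src′b′,src b)U_b)w|² ≤ κ₂²|w|²` ⟹
`|E u b′|² ≤ 2κ₁²·Σ_k a(tgt′b′,k)|u_k|² + 2κ₂²ρ·Σ_b q(b′,b)|u(tgt b)|²`. [our proof] -/
theorem defect_sq_le {a : X' → X → ℝ} {q : B' → B → ℝ} {src tgt : B → X} {src' tgt' : B' → X'}
    {O : X' → X → Matrix o o ℝ} {V : B' → Matrix o o ℝ} {U : B → Matrix o o ℝ} {κ₁ κ₂ ρ : ℝ} (b' : B')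
    (ha0 : ∀ k, 0 ≤ a (tgt' b') k) (ha1 : ∑ k, a (tgt' b') k ≤ 1) (hq0 : ∀ b, 0 ≤ q b' b) (hq1 : ∑ b, q b' b ≤ ρ)
    (hκ₁ : ∀ k (w : o → ℝ), ((V b' * O (tgt' b') k - O (src' b') k) *ᵥ w) ⬝ᵥ ((V b' * O (tgt' b') k - O (src' b') k) *ᵥ w) ≤ κ₁ ^ 2 * (w ⬝ᵥ w))
    (hκ₂ : ∀ b (w : o → ℝ), ((O (src' b') (tgt b) - O (src' b') (src b) * U b) *ᵥ w) ⬝ᵥ ((O (src' b') (tgt b) - O (src' b') (src b) * U b) *ᵥ w)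
      ≤ κ₂ ^ 2 * (w ⬝ᵥ w)) (u : X → o → ℝ) :
    (∑ k, a (tgt' b') k • ((V b' * O (tgt' b') k - O (src' b') k) *ᵥ u k)
        + ∑ b, q b' b • ((O (src' b') (tgt b) - O (src' b') (src b) * U b) *ᵥ u (tgt b))) ⬝ᵥ
      (∑ k, a (tgt' b') k • ((V b' * O (tgt' b') k - O (src' b') k) *ᵥ u k)
        + ∑ b, q b' b • ((O (src' b') (tgt b) - O (src' b') (src b) * U b) *ᵥ u (tgt b))) ≤
      2 * κ₁ ^ 2 * ∑ k, a (tgt' b') k * (u k ⬝ᵥ u k) + 2 * κ₂ ^ 2 * ρ * ∑ b, q b' b * (u (tgt b) ⬝ᵥ u (tgt b)) := by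
  refine (dotProduct_self_two_add_le _ _).trans ?_
  have hρ : 0 ≤ ρ := (Finset.sum_nonneg fun b _ => hq0 b).trans hq1
  have h1 := dotProduct_self_wsum_le' Finset.univ (fun k _ => ha0 k) ha1 (fun k => (V b' * O (tgt' b') k - O (src' b') k) *ᵥ u k)
  have h2 := dotProduct_self_wsum_le_mass Finset.univ (fun b _ => hq0 b) hq1 (fun b => (O (src' b') (tgt b) - O (src' b') (src b) * U b) *ᵥ u (tgt b))
  have h1' : ∑ k, a (tgt' b') k * (((V b' * O (tgt' b') k - O (src' b') k) *ᵥ u k) ⬝ᵥ ((V b' * O (tgt' b') k - O (src' b') k) *ᵥ u k)) ≤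
      κ₁ ^ 2 * ∑ k, a (tgt' b') k * (u k ⬝ᵥ u k) := by
    rw [Finset.mul_sum]
    refine Finset.sum_le_sum fun k _ => ?_
    have := mul_le_mul_of_nonneg_left (hκ₁ k (u k)) (ha0 k)
    linarith [this]
  have h2' : ∑ b, q b' b * (((O (src' b') (tgt b) - O (src' b') (src b) * U b) *ᵥ u (tgt b)) ⬝ᵥ
        ((O (src' b') (tgt b) - O (src' b') (src b) * U b) *ᵥ u (tgt b))) ≤ κ₂ ^ 2 * ∑ b, q b' b * (u (tgt b) ⬝ᵥ u (tgt b)) := by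
    rw [Finset.mul_sum]
    refine Finset.sum_le_sum fun b _ => ?_
    have := mul_le_mul_of_nonneg_left (hκ₂ b (u (tgt b))) (hq0 b)
    linarith [this]
  have h2'' := mul_le_mul_of_nonneg_left h2' hρ
  linarith [h1, h2, h1', h2'']

omit [DecidableEq o] [Fintype X'] in
/-- **`sum_defect_sq_le` — ALL FINE BONDS**: with the column sums `Σ_{b′} a(tgt′b′,k) ≤ α`, `Σ_{b′} q(b′,b) ≤ m` and the in-degree count `Σ_b |u(tgt b)|² ≤ g·|u|²`
(`0 ≤ ρ`, `0 ≤ m`), the per-bond bounds sum to `Σ_{b′}|E u b′|² ≤ (2κ₁²α + 2κ₂²ρmg)·|u|²`. [our proof] -/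
theorem sum_defect_sq_le {a : X' → X → ℝ} {q : B' → B → ℝ} {tgt : B → X} {tgt' : B' → X'} {κ₁ κ₂ ρ α m g : ℝ}
    {E : B' → o → ℝ} (u : X → o → ℝ) (hρ : 0 ≤ ρ) (hm : 0 ≤ m)
    (hE : ∀ b', E b' ⬝ᵥ E b' ≤ 2 * κ₁ ^ 2 * ∑ k, a (tgt' b') k * (u k ⬝ᵥ u k) + 2 * κ₂ ^ 2 * ρ * ∑ b, q b' b * (u (tgt b) ⬝ᵥ u (tgt b)))
    (hacol : ∀ k, ∑ b', a (tgt' b') k ≤ α) (hqcol : ∀ b, ∑ b', q b' b ≤ m) (hdeg : ∑ b, u (tgt b) ⬝ᵥ u (tgt b) ≤ g * ∑ k, u k ⬝ᵥ u k) :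
    ∑ b', E b' ⬝ᵥ E b' ≤ (2 * κ₁ ^ 2 * α + 2 * κ₂ ^ 2 * ρ * m * g) * ∑ k, u k ⬝ᵥ u k := by
  have huk : ∀ k, 0 ≤ u k ⬝ᵥ u k := fun k => dotProduct_self_nonneg' _
  have hA : ∑ b', ∑ k, a (tgt' b') k * (u k ⬝ᵥ u k) ≤ α * ∑ k, u k ⬝ᵥ u k := by
    rw [Finset.sum_comm, Finset.mul_sum]
    refine Finset.sum_le_sum fun k _ => ?_
    rw [← Finset.sum_mul]
    exact mul_le_mul_of_nonneg_right (hacol k) (huk k)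
  have hQ : ∑ b', ∑ b, q b' b * (u (tgt b) ⬝ᵥ u (tgt b)) ≤ m * (g * ∑ k, u k ⬝ᵥ u k) := by
    rw [Finset.sum_comm, ]
    calc ∑ b, ∑ b', q b' b * (u (tgt b) ⬝ᵥ u (tgt b)) ≤ ∑ b, m * (u (tgt b) ⬝ᵥ u (tgt b)) := by
          refine Finset.sum_le_sum fun b _ => ?_
          rw [← Finset.sum_mul]
          exact mul_le_mul_of_nonneg_right (hqcol b) (huk (tgt b))
      _ = m * ∑ b, u (tgt b) ⬝ᵥ u (tgt b) := by rw [Finset.mul_sum]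
      _ ≤ m * (g * ∑ k, u k ⬝ᵥ u k) := mul_le_mul_of_nonneg_left hdeg hm
  calc ∑ b', E b' ⬝ᵥ E b'
      ≤ ∑ b', (2 * κ₁ ^ 2 * ∑ k, a (tgt' b') k * (u k ⬝ᵥ u k) + 2 * κ₂ ^ 2 * ρ * ∑ b, q b' b * (u (tgt b) ⬝ᵥ u (tgt b))) :=
        Finset.sum_le_sum fun b' _ => hE b'
    _ = 2 * κ₁ ^ 2 * ∑ b', ∑ k, a (tgt' b') k * (u k ⬝ᵥ u k) + 2 * κ₂ ^ 2 * ρ * ∑ b', ∑ b, q b' b * (u (tgt b) ⬝ᵥ u (tgt b)) := by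
        rw [Finset.sum_add_distrib, Finset.mul_sum, Finset.mul_sum]
    _ ≤ 2 * κ₁ ^ 2 * (α * ∑ k, u k ⬝ᵥ u k) + 2 * κ₂ ^ 2 * ρ * (m * (g * ∑ k, u k ⬝ᵥ u k)) :=
        add_le_add (mul_le_mul_of_nonneg_left hA (by positivity)) (mul_le_mul_of_nonneg_left hQ (by positivity))
    _ = (2 * κ₁ ^ 2 * α + 2 * κ₂ ^ 2 * ρ * m * g) * ∑ k, u k ⬝ᵥ u k := by ring

end Defect

/-! ## §3 (PROL-ε,δ) from the flat identity: PART 28 fed by §1 and §2 -/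

section Prol

variable [DecidableEq X]

omit [DecidableEq o] [DecidableEq X] in
/-- `|u|² = Σ_k |u_k|²` for the flattened colour field. [folklore] -/
theorem dotProduct_self_eq_sum_curry (u : X × o → ℝ) : u ⬝ᵥ u = ∑ k, (fun i => u (k, i)) ⬝ᵥ (fun i => u (k, i)) := by
  simp only [dotProduct]
  exact Fintype.sum_prod_type _

omit [DecidableEq o] [Fintype X] [Fintype X'] [Fintype B'] [DecidableEq X] in
/-- Rescaling a transported weighted sum: `Σ_b (ρ⁻¹q_b)•W_b(ρ•x_b) = Σ_b q_b•W_b x_b` (`ρ ≠ 0`). [folklore] -/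
theorem sum_rescale_smul_mulVec {ρ : ℝ} (hρ : ρ ≠ 0) (c : B → ℝ) (W : B → Matrix o o ℝ) (x : B → o → ℝ) :
    ∑ b, (ρ⁻¹ * c b) • (W b *ᵥ (ρ • x b)) = ∑ b, c b • (W b *ᵥ x b) := by
  refine Finset.sum_congr rfl fun b _ => ?_
  rw [Matrix.mulVec_smul, smul_smul, mul_comm ρ⁻¹, mul_assoc, inv_mul_cancel₀ hρ, mul_one]

omit [DecidableEq o] [Fintype X] [Fintype X'] [Fintype B'] [DecidableEq X] in
/-- `Σ_b |ρ•x_b|² = ρ²·Σ_b |x_b|²`. [folklore] -/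
theorem sum_smul_dotProduct_smul (ρ : ℝ) (x : B → o → ℝ) : ∑ b, (ρ • x b) ⬝ᵥ (ρ • x b) = ρ * ρ * ∑ b, x b ⬝ᵥ x b := by
  rw [Finset.mul_sum]
  refine Finset.sum_congr rfl fun b _ => ?_
  rw [smul_dotProduct, dotProduct_smul, smul_eq_mul, smul_eq_mul, mul_assoc]

/-- **`prolGram_of_flat` — (PROL-ε,δ) FROM THE FLAT INTERTWINING IDENTITY** [our proof; PART 28 `posSemidef_intertwine_jensen` with `(X, Y, Q) := (X × o, X′ × o, P)`
at the RESCALED weights `ρ⁻¹q` and differences `ρ•(U_bu(tgt b) − u(src b))` — gan24-idea-1 g44's S-44-1]: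
the covariant prolongation `(Pu)(x′) = Σ_k a(x′,k)•O(x′,k)u_k` (structure `hP`) with ORTHOGONAL contour transports `O`, the flat identity (L) with weights `q ≥ 0`
of ROW MASS `≤ ρ` (`0 < ρ`; multilinear: `ρ = R⁻¹`) and column sums `≤ m`, prolongation weights `a ≥ 0` of row sums `≤ 1` and column sums `≤ α`, loop defects `κ₁`
(`k → tgt′b′ → src′b′ → k`) and `κ₂` (`tgt b → src b → src′b′ → tgt b`), the in-degree count `g`, the coarse form ABOVE its covariant bond energy
`w·Σ_b|U_bu(tgt b) − u(src b)|² ≤ ⟨u,Hu⟩`, the fine form BELOW `⟨v,H′v⟩ ≤ w′·Σ_{b′}|V_{b′}v(tgt′b′) − v(src′b′)|²`, `0 ≤ w′`, the slack condition `w′·m·ρ ≤ w`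
(multilinear at true stiffness: `R^{2−d}·R^{d−1}·R⁻¹·w = w`, equality), `H, H′` symmetric ⟹ for every `t > 0`:
`((1 + t)•H + ((1 + t⁻¹)·w′·(2κ₁²α + 2κ₂²ρmg))•1 − PᵀH′P).PosSemidef`. -/
theorem prolGram_of_flat {a : X' → X → ℝ} {q : B' → B → ℝ} {src tgt : B → X} {src' tgt' : B' → X'}
    {O : X' → X → Matrix o o ℝ} {V : B' → Matrix o o ℝ} {U : B → Matrix o o ℝ}
    {P : Matrix (X' × o) (X × o) ℝ} {H : Matrix (X × o) (X × o) ℝ} {H' : Matrix (X' × o) (X' × o) ℝ} {κ₁ κ₂ ρ α m g w w' : ℝ}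
    (hP : ∀ (u : X × o → ℝ) (x' : X'), (fun i => (P *ᵥ u) (x', i)) = ∑ k, a x' k • (O x' k *ᵥ fun i => u (k, i)))
    (hL : ∀ (v : X → o → ℝ) (b' : B'),
      ∑ k, a (tgt' b') k • v k - ∑ k, a (src' b') k • v k = ∑ b, q b' b • (v (tgt b) - v (src b)))
    (hO : ∀ x' k, (O x' k)ᵀ * O x' k = 1) (hρ : 0 < ρ)
    (hq0 : ∀ b' b, 0 ≤ q b' b) (hq1 : ∀ b', ∑ b, q b' b ≤ ρ) (hqcol : ∀ b, ∑ b', q b' b ≤ m) (hm : 0 ≤ m)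
    (ha0 : ∀ x' k, 0 ≤ a x' k) (ha1 : ∀ x', ∑ k, a x' k ≤ 1) (hacol : ∀ k, ∑ b', a (tgt' b') k ≤ α)
    (hκ₁ : ∀ b' k (w : o → ℝ), ((V b' * O (tgt' b') k - O (src' b') k) *ᵥ w) ⬝ᵥ ((V b' * O (tgt' b') k - O (src' b') k) *ᵥ w) ≤ κ₁ ^ 2 * (w ⬝ᵥ w))
    (hκ₂ : ∀ b' b (w : o → ℝ), ((O (src' b') (tgt b) - O (src' b') (src b) * U b) *ᵥ w) ⬝ᵥ ((O (src' b') (tgt b) - O (src' b') (src b) * U b) *ᵥ w)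
      ≤ κ₂ ^ 2 * (w ⬝ᵥ w))
    (hdeg : ∀ u : X → o → ℝ, ∑ b, u (tgt b) ⬝ᵥ u (tgt b) ≤ g * ∑ k, u k ⬝ᵥ u k)
    (hHs : Hᵀ = H) (hH's : H'ᵀ = H') (hw' : 0 ≤ w') (hw : w' * m * ρ ≤ w)
    (hH : ∀ u : X × o → ℝ,
      w * ∑ b, ((U b *ᵥ fun i => u (tgt b, i)) - fun i => u (src b, i)) ⬝ᵥ ((U b *ᵥ fun i => u (tgt b, i)) - fun i => u (src b, i)) ≤ u ⬝ᵥ (H *ᵥ u))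
    (hH' : ∀ v : X' × o → ℝ,
      v ⬝ᵥ (H' *ᵥ v) ≤ w' * ∑ b', ((V b' *ᵥ fun i => v (tgt' b', i)) - fun i => v (src' b', i)) ⬝ᵥ ((V b' *ᵥ fun i => v (tgt' b', i)) - fun i => v (src' b', i)))
    {t : ℝ} (ht : 0 < t) :
    ((1 + t) • H + ((1 + t⁻¹) * w' * (2 * κ₁ ^ 2 * α + 2 * κ₂ ^ 2 * ρ * m * g)) • (1 : Matrix (X × o) (X × o) ℝ) - Pᵀ * H' * P).PosSemidef := by
  have hρ0 : ρ ≠ 0 := hρ.ne'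
  have hρi : 0 ≤ ρ⁻¹ := inv_nonneg.mpr hρ.le
  -- PART 28 at the rescaled weights `ρ⁻¹q` (row sums ≤ 1, column sums ≤ ρ⁻¹m), differences `ρ•Du`, stiffness `ρ⁻²w`
  refine posSemidef_intertwine_jensen (P' := B') (P := B) (X := X × o) (Y := X' × o) (q := fun b' b => ρ⁻¹ * q b' b) (m := ρ⁻¹ * m)
    (wf := ρ⁻¹ * ρ⁻¹ * w) (W := fun b' b => O (src' b') (src b))
    (D := fun u b => ρ • ((U b *ᵥ fun i => u (tgt b, i)) - fun i => u (src b, i)))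
    (D' := fun v b' => (V b' *ᵥ fun i => v (tgt' b', i)) - fun i => v (src' b', i))
    (Eu := fun u b' => ∑ k, a (tgt' b') k • ((V b' * O (tgt' b') k - O (src' b') k) *ᵥ fun i => u (k, i))
      + ∑ b, q b' b • ((O (src' b') (tgt b) - O (src' b') (src b) * U b) *ᵥ fun i => u (tgt b, i)))
    (fun b' b => mul_nonneg hρi (hq0 b' b)) (fun b' => ?_) (fun b' b => hO _ _) (fun b => ?_) hw' ?_ hHs hH's (fun u => ?_) hH' (fun u b' => ?_)
    (fun u => ?_) ht
  · -- row sums of `ρ⁻¹q` are `≤ 1`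
    rw [← Finset.mul_sum]
    calc ρ⁻¹ * ∑ b, q b' b ≤ ρ⁻¹ * ρ := mul_le_mul_of_nonneg_left (hq1 b') hρi
      _ = 1 := inv_mul_cancel₀ hρ0
  · -- column sums of `ρ⁻¹q` are `≤ ρ⁻¹m`
    rw [← Finset.mul_sum]
    exact mul_le_mul_of_nonneg_left (hqcol b) hρi
  · -- the slack condition `w′·(ρ⁻¹m) ≤ ρ⁻²w` is `w′mρ ≤ w`
    have e : w' * (ρ⁻¹ * m) = ρ⁻¹ * ρ⁻¹ * (w' * m * ρ) := by field_simp
    rw [e]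
    exact mul_le_mul_of_nonneg_left hw (mul_nonneg hρi hρi)
  · -- the coarse form above the rescaled bond energy: `ρ⁻²w·Σ|ρ•Du|² = w·Σ|Du|²`
    rw [sum_smul_dotProduct_smul]
    have e : ∀ S : ℝ, ρ⁻¹ * ρ⁻¹ * w * (ρ * ρ * S) = w * S := fun S => by field_simp
    rw [e]
    exact hH u
  · -- the intertwining identity `D′(Pu) b′ = Σ_b (ρ⁻¹q) • (W *ᵥ ρ•D u b) + E u b′` is §1 at `u_k := (i ↦ u (k, i))`, rescaled
    rw [sum_rescale_smul_mulVec hρ0, hP u (tgt' b'), hP u (src' b')]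
    exact covariantLift_of_flat a q src tgt src' tgt' hL O V U (fun k => fun i => u (k, i)) b'
  · -- the defect mass
    have h := sum_defect_sq_le (E := fun b' => ∑ k, a (tgt' b') k • ((V b' * O (tgt' b') k - O (src' b') k) *ᵥ fun i => u (k, i))
        + ∑ b, q b' b • ((O (src' b') (tgt b) - O (src' b') (src b) * U b) *ᵥ fun i => u (tgt b, i)))
      (fun k => fun i => u (k, i)) hρ.le hm
      (fun b' => defect_sq_le b' (fun k => ha0 _ _) (ha1 _) (fun b => hq0 _ _) (hq1 _) (hκ₁ b') (hκ₂ b') fun k => fun i => u (k, i))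
      hacol hqcol (hdeg fun k => fun i => u (k, i))
    rw [dotProduct_self_eq_sum_curry u]
    exact h

end Prol

/-! ## §4 A background slack in the fine form (gan24-idea-1 g44's letter question Q-44-3, answered before it is asked) -/

section Slack

variable [DecidableEq X]

omit [Fintype B] [Fintype B'] in
/-- **`gram_le_colMass` — THE COVARIANT PROLONGATION IS BOUNDED**: structure `hP`, orthogonal contour transports, `a ≥ 0` with row sums `≤ 1` and column sums
over the FINE SITES `Σ_{x′} a(x′,k) ≤ α′` ⟹ `|Pu|² ≤ α′|u|²`, i.e. `(α′•1 − PᵀP).PosSemidef` (Jensen with transport, PART 27 BY NAME). [our proof] -/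
theorem gram_le_colMass {a : X' → X → ℝ} {O : X' → X → Matrix o o ℝ} {P : Matrix (X' × o) (X × o) ℝ} {α' : ℝ}
    (hP : ∀ (u : X × o → ℝ) (x' : X'), (fun i => (P *ᵥ u) (x', i)) = ∑ k, a x' k • (O x' k *ᵥ fun i => u (k, i)))
    (hO : ∀ x' k, (O x' k)ᵀ * O x' k = 1) (ha0 : ∀ x' k, 0 ≤ a x' k) (ha1 : ∀ x', ∑ k, a x' k ≤ 1) (hacol' : ∀ k, ∑ x', a x' k ≤ α') :
    (α' • (1 : Matrix (X × o) (X × o) ℝ) - Pᵀ * P).PosSemidef := by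
  refine PosSemidef.of_dotProduct_mulVec_nonneg ?_ fun u => ?_
  · rw [Matrix.IsHermitian, Matrix.conjTranspose_eq_transpose_of_trivial, transpose_sub, transpose_smul, transpose_one, transpose_mul,
      transpose_transpose]
  · simp only [star_trivial, sub_mulVec, smul_mulVec, one_mulVec, dotProduct_sub, dotProduct_smul, smul_eq_mul, sub_nonneg]
    have e : u ⬝ᵥ ((Pᵀ * P) *ᵥ u) = (P *ᵥ u) ⬝ᵥ (P *ᵥ u) := by
      rw [← mulVec_mulVec, dotProduct_mulVec, vecMul_transpose]
    rw [e, dotProduct_self_eq_sum_curry (P *ᵥ u), dotProduct_self_eq_sum_curry u]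
    calc ∑ x', (fun i => (P *ᵥ u) (x', i)) ⬝ᵥ (fun i => (P *ᵥ u) (x', i))
        ≤ ∑ x', ∑ k, a x' k * ((fun i => u (k, i)) ⬝ᵥ fun i => u (k, i)) := by
          refine Finset.sum_le_sum fun x' _ => ?_
          rw [hP u x']
          exact dotProduct_self_wsum_le Finset.univ (fun k _ => ha0 x' k) (ha1 x') (fun k _ => hO x' k) fun k => fun i => u (k, i)
      _ = ∑ k, (∑ x', a x' k) * ((fun i => u (k, i)) ⬝ᵥ fun i => u (k, i)) := by
          rw [Finset.sum_comm]
          exact Finset.sum_congr rfl fun k _ => (Finset.sum_mul _ _ _).symm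
      _ ≤ ∑ k, α' * ((fun i => u (k, i)) ⬝ᵥ fun i => u (k, i)) :=
          Finset.sum_le_sum fun k _ => mul_le_mul_of_nonneg_right (hacol' k) (dotProduct_self_nonneg' _)
      _ = α' * ∑ k, (fun i => u (k, i)) ⬝ᵥ fun i => u (k, i) := by rw [Finset.mul_sum]

/-- **`prolGram_of_flat_slack` — (PROL-ε,δ) WITH A BACKGROUND SLACK IN THE FINE FORM** [our proof]: §3 with the fine form bounded by its covariant bond energy
PLUS a mass `⟨v,H′v⟩ ≤ w′·Σ_{b′}|V_{b′}v(tgt′b′) − v(src′b′)|² + λ·|v|²` (`0 ≤ λ`; with a background the level-(j+1) action form carries an indefinite curvature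
term of size `O(‖F‖)·|v|²` that the flat-weight bond energy does not absorb — gan24-idea-1 g44's Q-44-3) and the fine-site column count `Σ_{x′} a(x′,k) ≤ α′`
⟹ for every `t > 0`: `((1 + t)•H + ((1 + t⁻¹)·w′·(2κ₁²α + 2κ₂²ρmg) + λα′)•1 − PᵀH′P).PosSemidef` (§3 at `H′ − λ•1`, plus `λ•(α′•1 − PᵀP)` from
`gram_le_colMass`). -/
theorem prolGram_of_flat_slack [DecidableEq X'] {a : X' → X → ℝ} {q : B' → B → ℝ} {src tgt : B → X} {src' tgt' : B' → X'}
    {O : X' → X → Matrix o o ℝ} {V : B' → Matrix o o ℝ} {U : B → Matrix o o ℝ}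
    {P : Matrix (X' × o) (X × o) ℝ} {H : Matrix (X × o) (X × o) ℝ} {H' : Matrix (X' × o) (X' × o) ℝ} {κ₁ κ₂ ρ α α' m g w w' lam : ℝ}
    (hP : ∀ (u : X × o → ℝ) (x' : X'), (fun i => (P *ᵥ u) (x', i)) = ∑ k, a x' k • (O x' k *ᵥ fun i => u (k, i)))
    (hL : ∀ (v : X → o → ℝ) (b' : B'),
      ∑ k, a (tgt' b') k • v k - ∑ k, a (src' b') k • v k = ∑ b, q b' b • (v (tgt b) - v (src b)))
    (hO : ∀ x' k, (O x' k)ᵀ * O x' k = 1) (hρ : 0 < ρ)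
    (hq0 : ∀ b' b, 0 ≤ q b' b) (hq1 : ∀ b', ∑ b, q b' b ≤ ρ) (hqcol : ∀ b, ∑ b', q b' b ≤ m) (hm : 0 ≤ m)
    (ha0 : ∀ x' k, 0 ≤ a x' k) (ha1 : ∀ x', ∑ k, a x' k ≤ 1) (hacol : ∀ k, ∑ b', a (tgt' b') k ≤ α) (hacol' : ∀ k, ∑ x', a x' k ≤ α')
    (hκ₁ : ∀ b' k (w : o → ℝ), ((V b' * O (tgt' b') k - O (src' b') k) *ᵥ w) ⬝ᵥ ((V b' * O (tgt' b') k - O (src' b') k) *ᵥ w) ≤ κ₁ ^ 2 * (w ⬝ᵥ w))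
    (hκ₂ : ∀ b' b (w : o → ℝ), ((O (src' b') (tgt b) - O (src' b') (src b) * U b) *ᵥ w) ⬝ᵥ ((O (src' b') (tgt b) - O (src' b') (src b) * U b) *ᵥ w)
      ≤ κ₂ ^ 2 * (w ⬝ᵥ w))
    (hdeg : ∀ u : X → o → ℝ, ∑ b, u (tgt b) ⬝ᵥ u (tgt b) ≤ g * ∑ k, u k ⬝ᵥ u k)
    (hHs : Hᵀ = H) (hH's : H'ᵀ = H') (hw' : 0 ≤ w') (hw : w' * m * ρ ≤ w) (hlam : 0 ≤ lam)
    (hH : ∀ u : X × o → ℝ,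
      w * ∑ b, ((U b *ᵥ fun i => u (tgt b, i)) - fun i => u (src b, i)) ⬝ᵥ ((U b *ᵥ fun i => u (tgt b, i)) - fun i => u (src b, i)) ≤ u ⬝ᵥ (H *ᵥ u))
    (hH' : ∀ v : X' × o → ℝ,
      v ⬝ᵥ (H' *ᵥ v) ≤ w' * ∑ b', ((V b' *ᵥ fun i => v (tgt' b', i)) - fun i => v (src' b', i)) ⬝ᵥ ((V b' *ᵥ fun i => v (tgt' b', i)) - fun i => v (src' b', i))
        + lam * (v ⬝ᵥ v))
    {t : ℝ} (ht : 0 < t) :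
    ((1 + t) • H + ((1 + t⁻¹) * w' * (2 * κ₁ ^ 2 * α + 2 * κ₂ ^ 2 * ρ * m * g) + lam * α') • (1 : Matrix (X × o) (X × o) ℝ) - Pᵀ * H' * P).PosSemidef := by
  have hH's' : (H' - lam • (1 : Matrix (X' × o) (X' × o) ℝ))ᵀ = H' - lam • 1 := by
    rw [transpose_sub, transpose_smul, transpose_one, hH's]
  have hH'' : ∀ v : X' × o → ℝ, v ⬝ᵥ ((H' - lam • (1 : Matrix (X' × o) (X' × o) ℝ)) *ᵥ v) ≤
      w' * ∑ b', ((V b' *ᵥ fun i => v (tgt' b', i)) - fun i => v (src' b', i)) ⬝ᵥ ((V b' *ᵥ fun i => v (tgt' b', i)) - fun i => v (src' b', i)) := by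
    intro v
    rw [sub_mulVec, smul_mulVec, one_mulVec, dotProduct_sub, dotProduct_smul, smul_eq_mul]
    linarith [hH' v]
  have h3 := prolGram_of_flat hP hL hO hρ hq0 hq1 hqcol hm ha0 ha1 hacol hκ₁ hκ₂ hdeg hHs hH's' hw' hw hH hH'' ht
  have h4 := (gram_le_colMass hP hO ha0 ha1 hacol').smul hlam
  have e : (1 + t) • H + ((1 + t⁻¹) * w' * (2 * κ₁ ^ 2 * α + 2 * κ₂ ^ 2 * ρ * m * g) + lam * α') • (1 : Matrix (X × o) (X × o) ℝ) - Pᵀ * H' * P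
      = ((1 + t) • H + ((1 + t⁻¹) * w' * (2 * κ₁ ^ 2 * α + 2 * κ₂ ^ 2 * ρ * m * g)) • (1 : Matrix (X × o) (X × o) ℝ)
          - Pᵀ * (H' - lam • (1 : Matrix (X' × o) (X' × o) ℝ)) * P)
        + lam • (α' • (1 : Matrix (X × o) (X × o) ℝ) - Pᵀ * P) := by
    rw [Matrix.mul_sub, Matrix.sub_mul, Matrix.mul_smul, Matrix.smul_mul, Matrix.mul_one, smul_sub, smul_smul]
    simp only [add_smul]
    abel
  rw [e]
  exact h3.add h4

end Slack

end Summit.QuantumFields.BalabanUV.Beta.GAN24.DerivativeRateTransferCovariantLift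

end
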